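import Summits.Ventures.PercRepro2.CaseOneTwoMarkCertI1
import Summits.Ventures.PercRepro2.CaseOneTwoMarkCertI2

/-!
# `a₃` adjacent exactly to `o` and `b`: `(i)` and `(J1₁)` for the class
(blind cell PercRepro2, p1 g15; S5 §2.1 (K9) (o), proofs/P1-TWOMARK.md §7)

**`zSplitI_of_twoMark`**: `(i)` for `a₃ ~ {o, b}`, every finite graph, every weight vector — the
Bernstein form `iQpoly_bern` with the eleven certified coefficients at the facts `tmFacts` of the
pinned law; with `zSplitII_of_twoMark` (CaseOneTwoMarkClose.lean), **`jOneOne_of_twoMark`**: `(J1₁)`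
for the class (`jOneOne_of_i_of_ii`). -/

namespace Summit.Ventures.PercRepro2

namespace CaseOne

/-! ## `(i)` and `(J1₁)` for the class -/

section ClosedI
variable {V : Type*} {E : Type*} [Fintype E] [DecidableEq E] [Fintype V] [DecidableEq V]
  {R : Type*} [Field R] [LinearOrder R] [IsStrictOrderedRing R]
variable {ends : E → Sym2 V} {o b a₃ : V} {eo eb : E}

/-- **`(i)` for `a₃` adjacent exactly to `o` and `b`, every finite graph, every weight vector.** -/
theorem zSplitI_of_twoMark (p : E → R) (hp : IsProbVec p)
    (h : IsTwoMarkAt ends o b a₃ eo eb) {a₁ a₂ : V} (h1 : a₁ ≠ a₃) (h2 : a₂ ≠ a₃) :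
    ZSplitI p ends o a₁ a₂ a₃ b := by
  unfold ZSplitI
  rw [iExpr_eq_iQpoly p h h1 h2]
  set p00 := Function.update (Function.update p eo 0) eb 0 with hp00
  have hp0 : IsProbVec p00 := (hp.update eo le_rfl zero_le_one).update eb le_rfl zero_le_one
  set m := tmMasses p00 ends o a₁ a₂ b with hm
  have hf : TMFacts m := tmFacts p00 hp0 ends o a₁ a₂ b
  have hr0 : 0 ≤ p eo := hp.nonneg eo
  have hr1 : 0 ≤ 1 - p eo := sub_nonneg.2 (hp.le_one eo)
  have hs0 : 0 ≤ p eb := hp.nonneg eb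
  have hs1 : 0 ≤ 1 - p eb := sub_nonneg.2 (hp.le_one eb)
  have w : ∀ (c : R) (i j : ℕ), 0 ≤ c →
      0 ≤ c * (p eo) ^ i * (1 - p eo) ^ (3 - i) * (p eb) ^ j * (1 - p eb) ^ (3 - j) := fun c i j hc =>
    mul_nonneg (mul_nonneg (mul_nonneg (mul_nonneg hc (pow_nonneg hr0 _)) (pow_nonneg hr1 _))
      (pow_nonneg hs0 _)) (pow_nonneg hs1 _)
  have key := iQpoly_bern (p eo) (p eb) m
  have h9 : 0 ≤ 9 * iQpoly (p eo) (p eb) m := by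
    rw [key]
    have t01 : 0 ≤ (3 : R) * p eo ^ 0 * (1 - p eo) ^ 3 * p eb ^ 1 * (1 - p eb) ^ 2 * tiB01 m :=
      mul_nonneg (w 3 0 1 (by norm_num)) (tiB01_nonneg m hf)
    have t02 : 0 ≤ (3 : R) * p eo ^ 0 * (1 - p eo) ^ 3 * p eb ^ 2 * (1 - p eb) ^ 1 * tiB02 m :=
      mul_nonneg (w 3 0 2 (by norm_num)) (tiB02_nonneg m hf)
    have t03 : 0 ≤ (1 : R) * p eo ^ 0 * (1 - p eo) ^ 3 * p eb ^ 3 * (1 - p eb) ^ 0 * tiB03 m :=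
      mul_nonneg (w 1 0 3 (by norm_num)) (tiB03_nonneg m hf)
    have t10 : 0 ≤ (3 : R) * p eo ^ 1 * (1 - p eo) ^ 2 * p eb ^ 0 * (1 - p eb) ^ 3 * tiB10 m :=
      mul_nonneg (w 3 1 0 (by norm_num)) (tiB10_nonneg m hf)
    have t11 : 0 ≤ (9 : R) * p eo ^ 1 * (1 - p eo) ^ 2 * p eb ^ 1 * (1 - p eb) ^ 2 * tiB11 m :=
      mul_nonneg (w 9 1 1 (by norm_num)) (tiB11_nonneg m hf)
    have t12 : 0 ≤ (9 : R) * p eo ^ 1 * (1 - p eo) ^ 2 * p eb ^ 2 * (1 - p eb) ^ 1 * tiB12 m :=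
      mul_nonneg (w 9 1 2 (by norm_num)) (tiB12_nonneg m hf)
    have t13 : 0 ≤ (3 : R) * p eo ^ 1 * (1 - p eo) ^ 2 * p eb ^ 3 * (1 - p eb) ^ 0 * tiB13 m :=
      mul_nonneg (w 3 1 3 (by norm_num)) (tiB13_nonneg m hf)
    have t20 : 0 ≤ (3 : R) * p eo ^ 2 * (1 - p eo) ^ 1 * p eb ^ 0 * (1 - p eb) ^ 3 * tiB20 m :=
      mul_nonneg (w 3 2 0 (by norm_num)) (tiB20_nonneg m hf)
    have t21 : 0 ≤ (9 : R) * p eo ^ 2 * (1 - p eo) ^ 1 * p eb ^ 1 * (1 - p eb) ^ 2 * tiB21 m :=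
      mul_nonneg (w 9 2 1 (by norm_num)) (tiB21_nonneg m hf)
    have t22 : 0 ≤ (9 : R) * p eo ^ 2 * (1 - p eo) ^ 1 * p eb ^ 2 * (1 - p eb) ^ 1 * tiB22 m :=
      mul_nonneg (w 9 2 2 (by norm_num)) (tiB22_nonneg m hf)
    have t23 : 0 ≤ (3 : R) * p eo ^ 2 * (1 - p eo) ^ 1 * p eb ^ 3 * (1 - p eb) ^ 0 * tiB23 m :=
      mul_nonneg (w 3 2 3 (by norm_num)) (tiB23_nonneg m hf)
    linarith [t01, t02, t03, t10, t11, t12, t13, t20, t21, t22, t23]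
  linarith [h9]

/-- **`(J1₁)` for `a₃` adjacent exactly to `o` and `b`**: from `(i)` and `(ii)`
(`jOneOne_of_i_of_ii`). -/
theorem jOneOne_of_twoMark (p : E → R) (hp : IsProbVec p)
    (h : IsTwoMarkAt ends o b a₃ eo eb) {a₁ a₂ : V} (h1 : a₁ ≠ a₃) (h2 : a₂ ≠ a₃) :
    JOneOne p ends o a₁ a₂ a₃ b :=
  jOneOne_of_i_of_ii p ends o a₁ a₂ a₃ b (zSplitI_of_twoMark p hp h h1 h2)
    (zSplitII_of_twoMark p hp h h1 h2)

end ClosedI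

end CaseOne

end Summit.Ventures.PercRepro2
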